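import Summits.QuantumFields.YangMills.Theorems.ColdStartUniversalityShenZhuZhuHaarCeilingSUN
import HarnessLib

/-!
# A POSITIVE SPECTRAL GAP AT EVERY COUPLING on every torus, every `SU(N)`, every `d` (Haar Poincaré `N/2` + Holley–Stroock):
# `(N/2)·e^{−2N|β'|·#𝒫} · Var_{μ_{Λ_L,β'}}(u) ≤ ∫ Γ(u,u) dμ_{Λ_L,β'}`, and the two-sided window `[(N/2)e^{−2N|β'|#𝒫}, N − 1/N]` for the optimal constant

Seat `ym-line-csu-p1` (g40), route `ColdStartUniversality` of `Summits/QuantumFields/YangMills`, helper file G37 (`--supports stmt-QuantumFields-24809`).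
g19 proved the `SU(2)`, `d = 3` instance in the seat's generator currency (`λ(L,β') = (3/2)e^{−4|β'|#𝒫}`); this file does every `SU(N)` (`N ≥ 1`), every
`d`, in the venture `YMGap`'s Γ-currency, from the venture's BUILT multi-link Bakry–Émery inequality at ZERO potential (product Haar measure, `K = N/2`)
and the Holley–Stroock bounded-perturbation argument with the explicit oscillation `osc(β'S_W) ≤ 2N|β'|·#𝒫` (`0 ≤ S_W ≤ 2N·#𝒫`, unitary trick bound
`|Re tr ρ| ≤ N`):

* §1 `haar_poincare_pi_sun` — `(N/2)·∫(u − ∫u dπ)² dπ ≤ ∫ Γ(u,u) dπ` on `SU(N)^{E⁺(Λ_L)}` under product Haar `π` (venture `poincare_gibbs` at `S = 0`);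
  `wilsonAction_nonneg`, `wilsonAction_le` — `0 ≤ S_W(U) ≤ 2N·#𝒫`.
* §2 ★★★ `torus_poincare_every_coupling_sun` — for EVERY `β'`, `L`, `N ≥ 1`, `d` and every smooth `u` of the link matrices:
  `(N/2)·e^{−2N|β'|·#𝒫}·Var_{μ_{Λ_L,β'}}(u) ≤ ∫ Γ(u,u) dμ_{Λ_L,β'}` (volume-dependent, but positive at every coupling).
* §3 ★★ `poincareConst_window_every_coupling_sun` — with G33's Haar ceiling: at every coupling the optimal Γ-Poincaré constant of `μ_{Λ_L,β'}` lies in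
  `[(N/2)e^{−2N|β'|·#𝒫}, N − 1/N]` (`N ≥ 2`, `L ≥ 2`).

THEOREMS ONLY, no definition, no sorry.  HONEST FRAMING: the lower bound is EXPONENTIALLY SMALL IN THE VOLUME (`#𝒫 = (d choose 2)·L^d`) — the trivial
fixed-cut-off bound, worthless along the route's scaling; nothing `K`-uniform (`UniformColdStartMixing`, 24809, ASIDE, not restated); no crux, rung or
summit statement is proved; the Yang–Mills mass gap is NOT proved.  References: R. Holley, D. Stroock, J. Stat. Phys. 46 (1987) 1159 [HolleyStroock1987];
D. Bakry, M. Émery, LNM 1123 (1985); H. Shen, R. Zhu, X. Zhu, CMP 400 (2023), Remark 4.6 [ShenZhuZhu2022].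
-/

set_option autoImplicit false

noncomputable section

namespace Summit.QuantumFields.YangMills.Theorems.ColdStartUniversality

open MeasureTheory ProbabilityTheory Finset Filter Set Function
open scoped BigOperators NNReal ENNReal Topology Matrix Matrix.Norms.Frobenius ContDiff
open Literature.MathematicalPhysics.QuantumFieldTheory
open Literature.MathematicalPhysics.QuantumLattice (fundamentalRep continuous_fundamentalRep fundamentalRep_apply)
open Literature.MathematicalPhysics.QuantumFieldTheory.SUNBakryEmery (SUN FrameIdx)
open Summit.Ventures.YMGap.LatticeBakryEmery (PSU Cfg emb emb_apply haarPi Gam algD algD_apply algD_const Gam_self_nonneg poincare_gibbs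
  const_mem_polySpace HessBound integrable_of_continuous_PSU continuous_restrict contDiff_Gam)

variable {d N L : ℕ} [NeZero L]

/-! ## §1. Haar Poincaré on `SU(N)^E` and the range of the Wilson action -/

/-- **Poincaré inequality for the product Haar measure on `SU(N)^{E⁺(Λ_L)}` with constant `N/2`** (Bakry–Émery, `Ric = N/2`; the venture `YMGap`'s
`poincare_gibbs` at zero potential): `(N/2)·∫ (u − ∫u dπ)² dπ ≤ ∫ Γ(u,u) dπ` for every smooth `u` of the link matrices. [cite: ShenZhuZhu2022, (4.8)] -/
theorem haar_poincare_pi_sun (hN : N ≠ 0) {u : Cfg (Edge d L) N → ℝ} (hu : ContDiff ℝ ∞ u) :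
    (N : ℝ) / 2 * ∫ U, (u (emb U) - ∫ V, u (emb V) ∂(haarPi (Edge d L) N)) ^ 2 ∂(haarPi (Edge d L) N) ≤
      ∫ U, Gam u u (emb U) ∂(haarPi (Edge d L) N) := by
  have hS : (fun _ : Cfg (Edge d L) N => (0 : ℝ)) ∈ Summit.Ventures.YMGap.LatticeBakryEmery.polySpace (Edge d L) N 0 := const_mem_polySpace 0 0
  have hH : HessBound (fun _ : Cfg (Edge d L) N => (0 : ℝ)) 0 := by
    intro g V _ _
    have h1 : algD V (fun _ : Cfg (Edge d L) N => (0 : ℝ)) = 0 := algD_const 0 V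
    have h2 : algD V (algD V (fun _ : Cfg (Edge d L) N => (0 : ℝ))) = 0 := by
      rw [h1]; exact algD_const 0 V
    rw [h2]; simp
  have hK : 0 < (N : ℝ) / 2 - 0 := by
    rw [sub_zero]; exact half_pos (Nat.cast_pos.2 (Nat.pos_of_ne_zero hN))
  have h := poincare_gibbs (ι := Edge d L) hN hS hH hK hu
  simp only [Real.exp_zero, one_mul, sub_zero, integral_const, probReal_univ, smul_eq_mul, mul_one, div_one] at h
  exact h

/-- `0 ≤ S_W(U)` for every configuration (`Re tr ρ(U_p) ≤ N`, unitary trick). [folklore] -/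
theorem wilsonAction_nonneg_sun (U : GaugeConfig d L (SUN N)) : 0 ≤ wilsonAction (fundamentalRep (Fin N)) U := by
  unfold wilsonAction
  refine Finset.sum_nonneg fun p _ => ?_
  have h := Literature.RepresentationTheory.CompactGroups.CompactGroup.abs_re_trace_le_card (fundamentalRep (Fin N))
    (continuous_fundamentalRep (n := Fin N)) (plaquetteHolonomy U p.1 p.2.1.1 p.2.1.2)
  rw [Fintype.card_fin] at h
  linarith [(abs_le.1 h).2]

/-- `S_W(U) ≤ 2N·#𝒫` for every configuration. [folklore] -/
theorem wilsonAction_le_sun (U : GaugeConfig d L (SUN N)) :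
    wilsonAction (fundamentalRep (Fin N)) U ≤ 2 * N * Fintype.card (Plaquette d L) := by
  unfold wilsonAction
  calc ∑ p : Plaquette d L, ((N : ℝ) - ((fundamentalRep (Fin N)) (plaquetteHolonomy U p.1 p.2.1.1 p.2.1.2)).trace.re)
      ≤ ∑ _p : Plaquette d L, (2 * N : ℝ) := Finset.sum_le_sum fun p _ => by
        have h := Literature.RepresentationTheory.CompactGroups.CompactGroup.abs_re_trace_le_card (fundamentalRep (Fin N))
          (continuous_fundamentalRep (n := Fin N)) (plaquetteHolonomy U p.1 p.2.1.1 p.2.1.2)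
        rw [Fintype.card_fin] at h
        linarith [(abs_le.1 h).1]
    _ = 2 * N * Fintype.card (Plaquette d L) := by rw [Finset.sum_const, Finset.card_univ, nsmul_eq_mul]; ring

/-- The Wilson weight `w = e^{−β'S_W}` compared at two configurations: `w(U) ≤ e^{2N|β'|·#𝒫} · w(V)` (oscillation of `β'S_W`). [cite: HolleyStroock1987, Lemma] -/
theorem wilsonWeight_le_exp_mul_sun (β' : ℝ) (U V : GaugeConfig d L (SUN N)) :
    Real.exp (-β' * wilsonAction (fundamentalRep (Fin N)) U) ≤
      Real.exp (2 * N * |β'| * Fintype.card (Plaquette d L)) * Real.exp (-β' * wilsonAction (fundamentalRep (Fin N)) V) := by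
  rw [← Real.exp_add]
  apply Real.exp_le_exp.2
  have hU0 := wilsonAction_nonneg_sun (d := d) (L := L) (N := N) U
  have hU1 := wilsonAction_le_sun (d := d) (L := L) (N := N) U
  have hV0 := wilsonAction_nonneg_sun (d := d) (L := L) (N := N) V
  have hV1 := wilsonAction_le_sun (d := d) (L := L) (N := N) V
  -- `−β' S(U) + β' S(V) ≤ |β'|·|S(V) − S(U)| ≤ |β'|·2N#P`
  have h1 : -β' * wilsonAction (fundamentalRep (Fin N)) U - -β' * wilsonAction (fundamentalRep (Fin N)) V ≤
      |β'| * (2 * N * Fintype.card (Plaquette d L)) := by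
    have h2 : -β' * wilsonAction (fundamentalRep (Fin N)) U - -β' * wilsonAction (fundamentalRep (Fin N)) V =
        β' * (wilsonAction (fundamentalRep (Fin N)) V - wilsonAction (fundamentalRep (Fin N)) U) := by ring
    rw [h2]
    refine (le_abs_self _).trans ?_
    rw [abs_mul]
    refine mul_le_mul_of_nonneg_left ?_ (abs_nonneg _)
    rw [abs_le]; constructor <;> linarith
  linarith

/-! ## §2. The Poincaré inequality at every coupling -/

/-- ★★★ **A positive spectral gap at EVERY coupling, every `SU(N)` (`N ≥ 1`), every `d`, every torus** (Holley–Stroock perturbation of the Haar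
Poincaré inequality): for every `β'`, `L` and every smooth `u` of the link matrices,
`(N/2)·e^{−2N|β'|·#𝒫} · Var_{μ_{Λ_L,β'}}(u) ≤ ∫ Γ(u,u) dμ_{Λ_L,β'}`, `μ_{Λ_L,β'} = wilsonMeasure (fundamentalRep (Fin N)) β'`.  HONEST: exponentially
small in the volume; the trivial fixed-cut-off bound.  The Yang–Mills mass gap is NOT proved. [cite: HolleyStroock1987, Lemma] -/
theorem torus_poincare_every_coupling_sun (hN : N ≠ 0) (β' : ℝ) {u : Cfg (Edge d L) N → ℝ} (hu : ContDiff ℝ ∞ u) :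
    (N : ℝ) / 2 * Real.exp (-(2 * N * |β'| * Fintype.card (Plaquette d L))) *
        Var[fun U : GaugeConfig d L (SUN N) => u (emb U); wilsonMeasure (d := d) (L := L) (fundamentalRep (Fin N)) β'] ≤
      ∫ U, Gam u u (emb U) ∂(wilsonMeasure (d := d) (L := L) (fundamentalRep (Fin N)) β') := by
  set μ := wilsonMeasure (d := d) (L := L) (fundamentalRep (Fin N)) β' with hμ
  set π := haarPi (Edge d L) N with hπ
  haveI : IsProbabilityMeasure μ := isProbabilityMeasure_wilsonMeasure (d := d) (L := L) (fundamentalRep (Fin N)) (continuous_fundamentalRep (n := Fin N)) β'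
  set w : GaugeConfig d L (SUN N) → ℝ := fun U => Real.exp (-β' * wilsonAction (fundamentalRep (Fin N)) U) with hw
  set A : ℝ := Real.exp (2 * N * |β'| * Fintype.card (Plaquette d L)) with hA
  have hApos : 0 < A := Real.exp_pos _
  have hwpos : ∀ U, 0 < w U := fun U => Real.exp_pos _
  have hwc : Continuous w := Real.continuous_exp.comp (continuous_const.mul
    ((Literature.Barriers.QuantumFields.Elitzur.continuous_wilsonAction (fundamentalRep (Fin N)) (continuous_fundamentalRep (n := Fin N)))))
  -- Wilson expectations as weighted Haar averages
  have hrep : ∀ φ : GaugeConfig d L (SUN N) → ℝ, ∫ U, φ U ∂μ = (∫ U, φ U * w U ∂π) / ∫ U, w U ∂π := by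
    intro φ
    have h := wilsonExpectation_eq_integral_div (d := d) (L := L) (fundamentalRep (Fin N)) (continuous_fundamentalRep (n := Fin N)) β' φ
    unfold wilsonExpectation at h
    exact h
  set Z : ℝ := ∫ U, w U ∂π with hZ
  have hZpos : 0 < Z := integral_exp_pos (integrable_of_continuous_PSU hwc _)
  -- smooth data
  have huc : Continuous fun U : GaugeConfig d L (SUN N) => u (emb U) := continuous_restrict hu
  have hGc : Continuous fun U : GaugeConfig d L (SUN N) => Gam u u (emb U) := continuous_restrict (contDiff_Gam hu hu)
  set m₀ : ℝ := ∫ V, u (emb V) ∂π with hm₀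
  -- (1) `Var_μ(u) ≤ ∫ (u − m₀)² dμ`
  have hmem : MemLp (fun U : GaugeConfig d L (SUN N) => u (emb U)) 2 μ := by
    obtain ⟨C, hC⟩ := (isCompact_univ (X := GaugeConfig d L (SUN N))).exists_bound_of_continuousOn huc.continuousOn
    exact MemLp.of_bound huc.aestronglyMeasurable C (ae_of_all _ fun U => hC U (Set.mem_univ _))
  have hvar_le : Var[fun U : GaugeConfig d L (SUN N) => u (emb U); μ] ≤ ∫ U, (u (emb U) - m₀) ^ 2 ∂μ := by
    rw [variance_eq_integral huc.measurable.aemeasurable]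
    set m : ℝ := ∫ U, u (emb U) ∂μ with hm
    have hi1 : Integrable (fun U : GaugeConfig d L (SUN N) => u (emb U)) μ := huc.integrable_of_hasCompactSupport (HasCompactSupport.of_compactSpace _)
    have hi2 : Integrable (fun U : GaugeConfig d L (SUN N) => (u (emb U) - m) ^ 2) μ :=
      ((huc.sub continuous_const).pow 2).integrable_of_hasCompactSupport (HasCompactSupport.of_compactSpace _)
    have hi3 : Integrable (fun U : GaugeConfig d L (SUN N) => 2 * (m - m₀) * (u (emb U) - m)) μ := (hi1.sub (integrable_const m)).const_mul _
    have hsplit : ∫ U, (u (emb U) - m₀) ^ 2 ∂μ = (∫ U, (u (emb U) - m) ^ 2 ∂μ) + (m - m₀) ^ 2 := by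
      have e1 : (fun U : GaugeConfig d L (SUN N) => (u (emb U) - m₀) ^ 2) =
          fun U => (u (emb U) - m) ^ 2 + (2 * (m - m₀) * (u (emb U) - m) + (m - m₀) ^ 2) := by
        funext U; ring
      have hi4 : Integrable (fun U : GaugeConfig d L (SUN N) => 2 * (m - m₀) * (u (emb U) - m) + (m - m₀) ^ 2) μ := hi3.add (integrable_const _)
      rw [e1, integral_add hi2 hi4, integral_add hi3 (integrable_const _), integral_const_mul,
        integral_sub hi1 (integrable_const m), integral_const, integral_const]
      simp only [probReal_univ, smul_eq_mul, one_mul]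
      rw [← hm]; ring
    rw [hsplit]
    show ∫ U, (u (emb U) - m) ^ 2 ∂μ ≤ (∫ U, (u (emb U) - m) ^ 2 ∂μ) + (m - m₀) ^ 2
    nlinarith [sq_nonneg (m - m₀)]
  -- a maximiser of the weight (compactness): `w ≤ w U₀ ≤ A · w V` for all `V`
  obtain ⟨U₀, -, hU₀⟩ := (isCompact_univ (X := GaugeConfig d L (SUN N))).exists_isMaxOn Set.univ_nonempty hwc.continuousOn
  have hwmax : ∀ U, w U ≤ w U₀ := fun U => hU₀ (Set.mem_univ U)
  have hw0A : ∀ V, w U₀ ≤ A * w V := fun V => wilsonWeight_le_exp_mul_sun (d := d) (L := L) (N := N) β' U₀ V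
  -- (2) `∫ (u − m₀)² dμ ≤ (w U₀ / Z) ∫ (u − m₀)² dπ`
  have hφc : Continuous fun U : GaugeConfig d L (SUN N) => (u (emb U) - m₀) ^ 2 := (huc.sub continuous_const).pow 2
  have h2 : ∫ U, (u (emb U) - m₀) ^ 2 ∂μ ≤ (w U₀ / Z) * ∫ U, (u (emb U) - m₀) ^ 2 ∂π := by
    rw [hrep, div_mul_eq_mul_div, div_le_div_iff_of_pos_right hZpos, ← integral_const_mul]
    refine integral_mono_of_nonneg (ae_of_all _ fun U => mul_nonneg (sq_nonneg _) (hwpos U).le)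
      ((integrable_of_continuous_PSU hφc _).const_mul _) (ae_of_all _ fun U => ?_)
    show (u (emb U) - m₀) ^ 2 * w U ≤ w U₀ * (u (emb U) - m₀) ^ 2
    nlinarith [sq_nonneg (u (emb U) - m₀), hwmax U]
  -- (3) Haar Poincaré and `w U₀ · ∫ Γ dπ ≤ A · Z · ∫ Γ dμ`
  have h3 := haar_poincare_pi_sun (d := d) (L := L) hN hu
  have h4 : w U₀ * ∫ U, Gam u u (emb U) ∂π ≤ A * (Z * ∫ U, Gam u u (emb U) ∂μ) := by
    rw [hrep, mul_div_cancel₀ _ hZpos.ne', ← integral_const_mul, ← integral_const_mul]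
    refine integral_mono_of_nonneg (ae_of_all _ fun U => mul_nonneg (hwpos U₀).le (Gam_self_nonneg u (emb U)))
      ((integrable_of_continuous_PSU (hGc.mul hwc) _).const_mul _) (ae_of_all _ fun U => ?_)
    show w U₀ * Gam u u (emb U) ≤ A * (Gam u u (emb U) * w U)
    nlinarith [hw0A U, Gam_self_nonneg u (emb U), (hwpos U).le]
  -- assemble: `(N/2)·Var ≤ A · ∫ Γ dμ`
  have hNpos : (0 : ℝ) < N := by exact_mod_cast Nat.pos_of_ne_zero hN
  have key : (N : ℝ) / 2 * Var[fun U : GaugeConfig d L (SUN N) => u (emb U); μ] ≤ A * ∫ U, Gam u u (emb U) ∂μ := by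
    have hw0 : 0 < w U₀ := hwpos U₀
    calc (N : ℝ) / 2 * Var[fun U : GaugeConfig d L (SUN N) => u (emb U); μ]
        ≤ (N : ℝ) / 2 * ((w U₀ / Z) * ∫ U, (u (emb U) - m₀) ^ 2 ∂π) := mul_le_mul_of_nonneg_left (hvar_le.trans h2) (by positivity)
      _ = (w U₀ / Z) * ((N : ℝ) / 2 * ∫ U, (u (emb U) - m₀) ^ 2 ∂π) := by ring
      _ ≤ (w U₀ / Z) * ∫ U, Gam u u (emb U) ∂π := mul_le_mul_of_nonneg_left h3 (by positivity)
      _ = (w U₀ * ∫ U, Gam u u (emb U) ∂π) / Z := by ring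
      _ ≤ (A * (Z * ∫ U, Gam u u (emb U) ∂μ)) / Z := div_le_div_of_nonneg_right h4 hZpos.le
      _ = A * ∫ U, Gam u u (emb U) ∂μ := by field_simp
  have hE : Real.exp (-(2 * N * |β'| * Fintype.card (Plaquette d L))) * A = 1 := by
    rw [hA, ← Real.exp_add, neg_add_cancel, Real.exp_zero]
  calc (N : ℝ) / 2 * Real.exp (-(2 * N * |β'| * Fintype.card (Plaquette d L))) * Var[fun U : GaugeConfig d L (SUN N) => u (emb U); μ]
      = Real.exp (-(2 * N * |β'| * Fintype.card (Plaquette d L))) * ((N : ℝ) / 2 * Var[fun U : GaugeConfig d L (SUN N) => u (emb U); μ]) := by ring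
    _ ≤ Real.exp (-(2 * N * |β'| * Fintype.card (Plaquette d L))) * (A * ∫ U, Gam u u (emb U) ∂μ) :=
        mul_le_mul_of_nonneg_left key (Real.exp_pos _).le
    _ = ∫ U, Gam u u (emb U) ∂μ := by rw [← mul_assoc, hE, one_mul]

/-! ## §3. The two-sided window at every coupling -/

/-- ★★ **The optimal Γ-Poincaré constant at EVERY coupling lies in `[(N/2)e^{−2N|β'|·#𝒫}, N − 1/N]`** (every `SU(N)` with `N ≥ 2`, every `d`, every
torus with `L ≥ 2` and a link `e₀`): the Holley–Stroock constant is admissible (§2) and every admissible constant is below the Haar ceiling (G33).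
The Yang–Mills mass gap is NOT proved. [cite: HolleyStroock1987, Lemma] -/
theorem poincareConst_window_every_coupling_sun (hN : 2 ≤ N) (hL : 1 < L) (β' : ℝ) (e₀ : Edge d L) :
    (∀ u : Cfg (Edge d L) N → ℝ, ContDiff ℝ ∞ u →
      (N : ℝ) / 2 * Real.exp (-(2 * N * |β'| * Fintype.card (Plaquette d L))) *
          Var[fun U : GaugeConfig d L (SUN N) => u (emb U); wilsonMeasure (d := d) (L := L) (fundamentalRep (Fin N)) β'] ≤
        ∫ U, Gam u u (emb U) ∂(wilsonMeasure (d := d) (L := L) (fundamentalRep (Fin N)) β')) ∧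
    (∀ c : ℝ, (∀ u : Cfg (Edge d L) N → ℝ, ContDiff ℝ ∞ u →
      c * Var[fun U : GaugeConfig d L (SUN N) => u (emb U); wilsonMeasure (d := d) (L := L) (fundamentalRep (Fin N)) β'] ≤
        ∫ U, Gam u u (emb U) ∂(wilsonMeasure (d := d) (L := L) (fundamentalRep (Fin N)) β')) → c ≤ (N : ℝ) - 1 / N) ∧
    (N : ℝ) / 2 * Real.exp (-(2 * N * |β'| * Fintype.card (Plaquette d L))) ≤ (N : ℝ) - 1 / N := by
  have hN0 : N ≠ 0 := by omega
  refine ⟨fun u hu => torus_poincare_every_coupling_sun (L := L) hN0 β' hu, fun c hc => poincareConst_le_haarCeiling_sun hN hL β' e₀ hc,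
    poincareConst_le_haarCeiling_sun hN hL β' e₀ fun u hu => torus_poincare_every_coupling_sun (L := L) hN0 β' hu⟩

end Summit.QuantumFields.YangMills.Theorems.ColdStartUniversality

end
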